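import Summits.HodgeConjecture.HodgeConjecture.Theorems.AnchorTransportVariationalHodgeClosing
import Literature.AlgebraicGeometry.HodgeTheory.AlgebraicityLocusIUnionClosedProofs
import Literature.AlgebraicGeometry.Motives.VeryGeneralComplexPoint
import Literature.AlgebraicGeometry.HodgeTheory.GysinKernel
import HarnessLib

/-!
# Ring 2 · route `deform`, II-a — spreading algebraicity from a set of fibres: uniform strata, the Baire threshold

HONEST FRAMING: research route conditional on HC_CM; not a corollary; Q11.4-sentence-2 already refuted in dim ≥ 3.

Cell `pub-hodge-ring2`, seat `pub-hodge-ring2-deform` (gen 3), part II-a of row U (part II-b: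
`Ring2DeformUniformAlgebraicity.lean` types the inputs and proves `HC_AV ↔ HC_CM ∧ UniformAlgebraicityAtCMPoints`).
Nothing here mentions the Hodge conjecture: this file is the TOPOLOGY of spreading, all PROVED from the tree's
structure theorem for algebraicity loci (`charlesSchnell_algebraicityLocus_iUnion_closed_holds`: the locus where a
global class restricts to an algebraic class is a COUNTABLE UNION `⋃ⱼ Wⱼ(ℂ)` of complex points of Zariski-closed
`Wⱼ ⊆ S` — Charles–Schnell Prop. 11.3.11, Voisin II §3.3.1) and Baire (tree: `variationalHodge_closing_of_thickSet`,
`exists_eq_univ_of_isOpen_subset_iUnion`). Sorry-free; axioms `propext`, `Classical.choice`, `Quot.sound` only.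

* UNIFORM STRATA: `forall_mem_algebraicClasses_of_dense_of_subset_closed` — if a DENSE `Λ ⊆ S(ℂ)` lies in ONE
  Zariski-closed `W ⊆ S` all of whose complex points carry an algebraic fibre class ("`A` is uniformly algebraic
  along `Λ`"), then `A` is algebraic at EVERY fibre; `exists_closed_stratum_iff_forall_of_dense` — along a dense
  `Λ` such a stratum exists IFF every fibre class is algebraic (uniformity is exactly what density needs, no more);
  `exists_closed_stratum_of_finite_strata` — finitely many closed strata covering `Λ` suffice (bounded degree of
  the representing cycles, Voisin II §3.3.1).
* THRESHOLD `forall_mem_algebraicClasses_of_not_isMeagre` — a NON-MEAGRE set of algebraic fibres spreads to every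
  fibre; DICHOTOMY `forall_mem_algebraicClasses_or_dense_not_mem` — either every fibre class is algebraic or the
  NON-algebraic fibres are dense. A countable dense set (the CM points of a Mumford–Tate family) is meagre: this is
  the precise content of the no-go "density of CM points + HC_CM + Principle B do not give HC_AV" (tree:
  `Markman2025.cmDensity_insufficient`), and the reason row U needs an input at all.

References: [CharlesSchnell2014Notes] Prop. 11.3.11 (structure of the algebraicity locus), Thm. 11.3.7 (Principle B);
[VoisinHodgeII2003] §3.3.1, §5.3.1, §7.3.2; [Deligne1982HodgeCycles] Thm. 2.12, Prop. 6.1, §6 pp. 59–61.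
PerL / QW8 / the 2001 programme are cited nowhere.
-/

set_option linter.dupNamespace false

noncomputable section

namespace Summit.HodgeConjecture.HodgeConjecture.Ring2.Deform

open CategoryTheory AlgebraicGeometry
open Literature.AlgebraicGeometry Literature.AlgebraicGeometry.Motives
open Literature.AlgebraicGeometry.HodgeTheory
open Literature.AlgebraicTopology.SingularHomology
open Summit.HodgeConjecture.HodgeConjecture
open Summit.HodgeConjecture.HodgeConjecture.Cruxes.HodgeAbelianVarieties.SubtorusGalleryBlochSeeds.Stubs
  (exists_eq_univ_of_isOpen_subset_iUnion)

variable {𝒳 S : SchemeOver ℂ}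

/-! ## §A Spreading from a set of fibres: uniform strata -/

/-- A closed set containing a dense set is everything. [folklore] -/
theorem eq_univ_of_dense_of_subset_closed {X : Type*} [TopologicalSpace X] {D C : Set X} (hD : Dense D)
    (hC : IsClosed C) (hDC : D ⊆ C) : C = Set.univ := by
  have h : closure D ⊆ C := hC.closure_subset_iff.2 hDC
  rw [hD.closure_eq] at h
  exact Set.eq_univ_of_univ_subset h

/-- **Spreading lemma (dense + ONE closed stratum ⟹ everywhere).** Say `A` is UNIFORMLY ALGEBRAIC ALONG
`Λ ⊆ S(ℂ)` if there is one Zariski-closed `W ⊆ S` such that `A|_{𝒳_t}` is algebraic at every complex point of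
`W` and every point of `Λ` lies in `W(ℂ)` (by the structure theorem the algebraicity locus is `⋃ⱼ Wⱼ(ℂ)` —
relative Hilbert schemes of bounded Hilbert polynomial, proper over `S`, image closed — and uniformity says
FINITELY MANY `Wⱼ` cover `Λ`, `exists_closed_stratum_of_finite_strata`: the representing cycles along `Λ` have
BOUNDED DEGREE). If moreover `Λ` is dense (analytic topology), then `A|_{𝒳_t}` is algebraic for EVERY
`t ∈ S(ℂ)`: `W(ℂ)` is closed (`isClosed_setOf_pt_mem`, GAGA) and contains the dense `Λ`, so `W(ℂ) = S(ℂ)`. Pure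
topology — no hypothesis on `f`, `S` or `A`. This is the step Deligne's Principle B performs for ABSOLUTE HODGE
classes (whose locus is closed, Thm. 2.12) and which fails for ALGEBRAIC classes without the uniformity (countable
union of closed strata; `Markman2025.cmDensity_insufficient`). [cite: Deligne1982HodgeCycles, Thm. 2.12 and §6
proof of Prop. 6.1 (p. 59: "(b) will hold for a dense set of points")] [cite: CharlesSchnell2014Notes, Prop. 11.3.11]
[cite: VoisinHodgeII2003, §3.3.1 ("the image of `H_{i,U}` under the second projection onto `U` is a closed
algebraic subset of `U`")] -/
theorem forall_mem_algebraicClasses_of_dense_of_subset_closed (f : 𝒳 ⟶ S) {p : ℕ}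
    {A : complexBetti 𝒳 (2 * p)} {Λ : Set (ComplexPoints S)} (hΛ : Dense Λ) {W : Set S.left}
    (hWc : IsClosed W)
    (hWalg : ∀ t : ComplexPoints S, t.pt ∈ W →
      complexBetti.map (fiberι f t) (2 * p) A ∈ algebraicClasses (fiberOver f t) p)
    (hΛW : ∀ t ∈ Λ, t.pt ∈ W) (t : ComplexPoints S) :
    complexBetti.map (fiberι f t) (2 * p) A ∈ algebraicClasses (fiberOver f t) p := by
  have huniv : {t : ComplexPoints S | t.pt ∈ W} = Set.univ :=
    eq_univ_of_dense_of_subset_closed hΛ (isClosed_setOf_pt_mem hWc) fun s hs => hΛW s hs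
  have ht : t ∈ {t : ComplexPoints S | t.pt ∈ W} := by
    rw [huniv]
    exact Set.mem_univ t
  exact hWalg t ht

/-- ON-PATH / a-posteriori uniformity: if `A` is algebraic at every fibre, it is uniformly algebraic along any
`Λ` (take `W = S`). [folklore] -/
theorem exists_closed_stratum_of_forall (f : 𝒳 ⟶ S) {p : ℕ} {A : complexBetti 𝒳 (2 * p)}
    (h : ∀ t : ComplexPoints S, complexBetti.map (fiberι f t) (2 * p) A ∈ algebraicClasses (fiberOver f t) p)
    (Λ : Set (ComplexPoints S)) :
    ∃ W : Set S.left, IsClosed W ∧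
      (∀ t : ComplexPoints S, t.pt ∈ W →
        complexBetti.map (fiberι f t) (2 * p) A ∈ algebraicClasses (fiberOver f t) p) ∧
      ∀ t ∈ Λ, t.pt ∈ W :=
  ⟨Set.univ, isClosed_univ, fun t _ => h t, fun _ _ => Set.mem_univ _⟩

/-- Hence along a DENSE `Λ`, uniform algebraicity (one closed stratum of algebraic fibres containing `Λ`) is
EQUIVALENT to algebraicity at every fibre: uniformity is exactly what density needs, no more. [folklore] -/
theorem exists_closed_stratum_iff_forall_of_dense (f : 𝒳 ⟶ S) {p : ℕ} {A : complexBetti 𝒳 (2 * p)}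
    {Λ : Set (ComplexPoints S)} (hΛ : Dense Λ) :
    (∃ W : Set S.left, IsClosed W ∧
      (∀ t : ComplexPoints S, t.pt ∈ W →
        complexBetti.map (fiberι f t) (2 * p) A ∈ algebraicClasses (fiberOver f t) p) ∧
      ∀ t ∈ Λ, t.pt ∈ W) ↔
      ∀ t : ComplexPoints S, complexBetti.map (fiberι f t) (2 * p) A ∈ algebraicClasses (fiberOver f t) p :=
  ⟨fun ⟨_, hWc, hWalg, hΛW⟩ => forall_mem_algebraicClasses_of_dense_of_subset_closed f hΛ hWc hWalg hΛW,
    fun h => exists_closed_stratum_of_forall f h Λ⟩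

/-- **Finitely many strata ⟹ uniform.** If finitely many Zariski-closed `Wᵢ ⊆ S`, each consisting of algebraic
fibres, cover `Λ`, then ONE closed stratum of algebraic fibres contains `Λ` (`W = ⋃ᵢ Wᵢ`, a finite union of
closed sets). With the `Wᵢ` among the strata of the Charles–Schnell decomposition (images of relative Hilbert
schemes of bounded Hilbert polynomial) this is "the representing cycles along `Λ` have bounded degree".
[cite: VoisinHodgeII2003, §3.3.1] [cite: CharlesSchnell2014Notes, Prop. 11.3.11 (proof)] -/
theorem exists_closed_stratum_of_finite_strata (f : 𝒳 ⟶ S) {p : ℕ} {A : complexBetti 𝒳 (2 * p)}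
    {Λ : Set (ComplexPoints S)} {ι : Type*} [Finite ι] (W : ι → Set S.left) (hWc : ∀ i, IsClosed (W i))
    (hWalg : ∀ i (t : ComplexPoints S), t.pt ∈ W i →
      complexBetti.map (fiberι f t) (2 * p) A ∈ algebraicClasses (fiberOver f t) p)
    (hΛ : ∀ t ∈ Λ, ∃ i, t.pt ∈ W i) :
    ∃ W : Set S.left, IsClosed W ∧
      (∀ t : ComplexPoints S, t.pt ∈ W →
        complexBetti.map (fiberι f t) (2 * p) A ∈ algebraicClasses (fiberOver f t) p) ∧
      ∀ t ∈ Λ, t.pt ∈ W := by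
  refine ⟨⋃ i, W i, isClosed_iUnion_of_finite hWc, fun t ht => ?_, fun t ht => Set.mem_iUnion.2 (hΛ t ht)⟩
  obtain ⟨i, hi⟩ := Set.mem_iUnion.1 ht
  exact hWalg i t hi

/-! ## §A' The Baire threshold and the dichotomy (from the PROVED structure theorem) -/

/-- **Threshold: a NON-MEAGRE set of algebraic fibres spreads to every fibre.** If `A|_{𝒳_t}` is algebraic for
all `t` in a set `Λ ⊆ S(ℂ)` which is not meagre (second Baire category), then it is algebraic at every `t`: the
locus is `⋃ⱼ Wⱼ(ℂ)`; were every `Wⱼ ⊊ S`, each `Wⱼ(ℂ)` would be closed with empty interior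
(`Motives.ComplexPoints.interior_setOf_pt_mem_eq_empty`), so the locus — and `Λ` — would be meagre. A countable
`Λ` in a base of positive dimension is meagre: the CM points of a Mumford–Tate family do NOT meet the threshold,
which is why row U needs an input. Tree glue: `Theorems.variationalHodge_closing_of_thickSet` with the structure
theorem discharged; the OPEN-set case (what a local deformation engine at ONE CM fibre would feed) is the tree's
`Theorems.variationalHodge_conclusion_of_isOpen` / `forall_mem_algebraicClasses_of_isOpen_nonempty`, not restated
here. [cite: CharlesSchnell2014Notes, Prop. 11.3.11 (proof)]
[cite: VoisinHodgeII2003, §7.3.2, proof of Thm. 7.19] -/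
theorem forall_mem_algebraicClasses_of_not_isMeagre (f : 𝒳 ⟶ S) {n p : ℕ} (h𝒳 : IsQuasiProjectiveOver 𝒳)
    (hS : IsQuasiProjectiveOver S) (hSsm : AlgebraicGeometry.Smooth S.hom) [IrreducibleSpace S.left]
    (hf : IsSmoothProjectiveFamily f n) (A : complexBetti 𝒳 (2 * p)) {Λ : Set (ComplexPoints S)}
    (hΛ : ¬ IsMeagre Λ)
    (halg : ∀ t ∈ Λ, complexBetti.map (fiberι f t) (2 * p) A ∈ algebraicClasses (fiberOver f t) p)
    (t : ComplexPoints S) :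
    complexBetti.map (fiberι f t) (2 * p) A ∈ algebraicClasses (fiberOver f t) p := by
  refine Theorems.variationalHodge_closing_of_thickSet f charlesSchnell_algebraicityLocus_iUnion_closed_holds
    h𝒳 hS hSsm hf A Λ (fun Z hZc hZne hsub => hΛ ?_) halg t
  haveI : LocallyOfFiniteType S.hom := locallyOfFiniteType_of_isQuasiProjectiveOver hS
  have hmeagre : ∀ k, IsMeagre {t : ComplexPoints S | t.pt ∈ Z k} := fun k =>
    (((isClosed_setOf_pt_mem (hZc k)).isNowhereDense_iff).2
      (ComplexPoints.interior_setOf_pt_mem_eq_empty (hZc k) (hZne k))).isMeagre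
  exact (isMeagre_iUnion hmeagre).mono hsub

/-- **Dichotomy.** For every global class `A` on a smooth projective family over a smooth irreducible
quasi-projective base: EITHER `A|_{𝒳_t}` is algebraic at every `t ∈ S(ℂ)`, OR the set of `t` where it is NOT
algebraic is DENSE in `S(ℂ)`. (Structure theorem: if some stratum `Wⱼ = S` every fibre is algebraic; otherwise
no non-empty open set lies in the locus, by `exists_eq_univ_of_isOpen_subset_iUnion` — Baire + irreducibility.)
So, short of "algebraic everywhere", the non-algebraic fibres are themselves dense: "algebraic on a dense set of
fibres" carries no information by itself, while "algebraic on a non-meagre (e.g. open) set" is everything.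
[cite: CharlesSchnell2014Notes, Prop. 11.3.11] [cite: VoisinHodgeII2003, §5.3.1 and §7.3.2] -/
theorem forall_mem_algebraicClasses_or_dense_not_mem (f : 𝒳 ⟶ S) {n p : ℕ} (h𝒳 : IsQuasiProjectiveOver 𝒳)
    (hS : IsQuasiProjectiveOver S) (hSsm : AlgebraicGeometry.Smooth S.hom) [IrreducibleSpace S.left]
    (hf : IsSmoothProjectiveFamily f n) (A : complexBetti 𝒳 (2 * p)) :
    (∀ t : ComplexPoints S, complexBetti.map (fiberι f t) (2 * p) A ∈ algebraicClasses (fiberOver f t) p) ∨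
      Dense {t : ComplexPoints S |
        complexBetti.map (fiberι f t) (2 * p) A ∉ algebraicClasses (fiberOver f t) p} := by
  obtain ⟨W, hWc, hL⟩ := charlesSchnell_algebraicityLocus_iUnion_closed_holds f n p h𝒳 hS hSsm hf A
  by_cases huniv : ∃ j, W j = Set.univ
  · obtain ⟨j, hj⟩ := huniv
    refine Or.inl fun t => ?_
    have ht : t ∈ ⋃ j, {t : ComplexPoints S | t.pt ∈ W j} :=
      Set.mem_iUnion.2 ⟨j, by simp only [Set.mem_setOf_eq, hj, Set.mem_univ]⟩
    rw [← hL] at ht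
    exact ht
  · have huniv' : ∀ j, W j ≠ Set.univ := fun j hj => huniv ⟨j, hj⟩
    refine Or.inr (dense_iff_inter_open.2 fun U hU hUne => ?_)
    by_contra hempty
    have hUW : U ⊆ ⋃ j, {t : ComplexPoints S | t.pt ∈ W j} := by
      intro t htU
      rw [← hL]
      by_contra hnot
      exact hempty ⟨t, htU, hnot⟩
    obtain ⟨j, hj⟩ := exists_eq_univ_of_isOpen_subset_iUnion hS hWc hU hUne hUW
    exact huniv' j hj

#print axioms Summit.HodgeConjecture.HodgeConjecture.Ring2.Deform.forall_mem_algebraicClasses_of_dense_of_subset_closed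
#print axioms Summit.HodgeConjecture.HodgeConjecture.Ring2.Deform.forall_mem_algebraicClasses_of_not_isMeagre
#print axioms Summit.HodgeConjecture.HodgeConjecture.Ring2.Deform.forall_mem_algebraicClasses_or_dense_not_mem

end Summit.HodgeConjecture.HodgeConjecture.Ring2.Deform
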